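import Literature.Analysis.FluidPDE.OseenKernelSemigroup
import Literature.Analysis.FluidPDE.OseenKernelLp
import Literature.Analysis.UnboundedOperators.HeatIteratedDerivBounds
import HarnessLib

/-!
# The Oseen slice operator `N_σ[a, b] = e^{σΔ} P ∇·(a ⊗ b)` on bounded fields: bounds,
# semigroup law, smoothness, and derivatives on `C¹` data

Analysis/FluidPDE support file (all results proved; no named facts) on the discharge path of the
regularity of bounded weak solutions of the Navier–Stokes equations,
Koch–Nadirashvili–Seregin–Šverák, Acta Math. 203 (2009) = arXiv:0709.3599, §4 (the named facts
`KNSS2009_regularity_boundedWeak_ancient_planar`, `KNSS2009_driftMild_regularity`). The mild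
(Oseen) form of the equations is `u(t) = e^{(t−s)Δ}u(s) − ∫ₛᵗ N_{t−τ}[u(τ), u(τ)] dτ` with the
**slice operator**

  `N_σ[a, b](x) = ∫ K(σ, x − y)[a(y), b(y)] dy = (e^{σΔ} P ∇·(a ⊗ b))(x)`,

`K = oseenKernel` the Oseen–Koch–Tataru kernel of the tree (`KochTataru.lean`; the time integral
of these slices is the tree's `oseenDuhamel ν s u v t x = ∫ N_{ν(t−τ)}[u τ, v τ](x) dτ`,
`NSBoundedMildOseen.lean`, definitionally). KNSS §4 runs the
regularity bootstrap on this operator ("The key is an estimate of `B` with the same form as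
`‖B(u,v)‖ ≤ C√T‖u‖‖v‖` but in spaces with norms given by `‖t^{k/2}∇ᵏₓu‖_∞`", p. 8). This file
provides its elementary calculus on **bounded** fields, in any finite-dimensional `E`:

* `oseenKernelCLM σ z : E →L[ℝ] E →L[ℝ] E`, the kernel as a continuous bilinear map (for the
  product rule), with the bound `‖K(σ, z)‖ ≤ C (σ + ‖z‖²)^{-(d+1)/2}` (Koch–Tataru's (14));
* `oseenSlice σ a b`, the slice operator; the sup bound
  `‖N_σ[a, b](x)‖ ≤ C₀ σ^{-1/2} M_a M_b` (`norm_oseenSlice_le`; KNSS §3 (3.5): the kernel decay);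
  strong measurability with parameters (`stronglyMeasurable_oseenSlice_param`; the plain slice
  is the tree's `stronglyMeasurable_oseenSlice`, `OseenKernelLp.lean`);
  bilinearity on bounded measurable fields;
* **semigroup law** `e^{tΔ}(N_σ[a, b]) = N_{σ+t}[a, b]` (`heatExtension_oseenSlice`, from the
  kernel-level law `e^{tΔ}K(σ) = K(σ + t)` of `OseenKernelSemigroup.lean` and Fubini);
* hence **smoothness** of `N_σ[a, b]` for bounded measurable `a, b` and the all-order bounds
  `‖Dᵏ N_σ[a, b](x)‖ ≤ C_k σ^{-(k+1)/2} M_a M_b` (`exists_norm_iteratedFDeriv_oseenSlice_le`, via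
  `N_σ = e^{(σ/2)Δ} N_{σ/2}` and the heat-semigroup derivative bounds of
  `HeatIteratedDerivBounds`): the kernel of `e^{σΔ}P∇·` smooths like `∇G_σ` (KNSS Prop. 4.1,
  Remark 4.2);
* **derivatives fall on `C¹` data**: `∂_h N_σ[a, b] = N_σ[∂_h a, b] + N_σ[a, ∂_h b]` for bounded
  `C¹` fields with bounded derivatives (`fderiv_oseenSlice_apply_of_contDiff`; translation
  invariance `N_σ[a,b](x) = ∫ K(σ, z)[a(x − z), b(x − z)] dz` and differentiation under the
  integral sign), the form in which KNSS "take difference quotients" ((3.12)–(3.13)).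

## References

* G. Koch, N. Nadirashvili, G. Seregin, V. Šverák, *Liouville theorems for the Navier–Stokes
  equations and applications*, Acta Math. 203 (2009) 83–105 = arXiv:0709.3599v1: §3 (3.3)–(3.5),
  (3.12)–(3.13); §4 p. 8 (`B(u,v)`, Prop. 4.1, Remark 4.2). [KochNadirashviliSereginSverak2009]
* H. Koch, D. Tataru, Adv. Math. 157 (2001), §2 (8), §3 (14). [KochTataruAdvMath2001]
-/

noncomputable section

open MeasureTheory Set Function Filter Metric Real
open _root_.Topology
open scoped ENNReal NNReal RealInnerProductSpace ContDiff

namespace Literature.Analysis.FluidPDE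

open UnboundedOperators (heatKernel heatExtension)

variable {E : Type*} [NormedAddCommGroup E] [InnerProductSpace ℝ E] [FiniteDimensional ℝ E]
  [MeasurableSpace E] [BorelSpace E]

/-! ### The kernel as a continuous bilinear map -/

section KernelCLM

/-- The Oseen–Koch–Tataru kernel `K(σ, z)[·, ·]` as a **continuous bilinear map**
`E →L[ℝ] E →L[ℝ] E` (bilinear by construction, `oseenKernel_add_left`, …; bounded by the
explicit envelope of `norm_oseenKernel_le`). [cite: KochTataruAdvMath2001, §2 (8)] -/
def oseenKernelCLM (σ : ℝ) (z : E) : E →L[ℝ] E →L[ℝ] E :=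
  LinearMap.mkContinuous₂
    (LinearMap.mk₂ ℝ (oseenKernel σ z) (oseenKernel_add_left σ z)
      (fun c a b => oseenKernel_smul_left σ z c a b) (oseenKernel_add_right σ z)
      (fun c a b => oseenKernel_smul_right σ z c a b))
    (‖z‖ * |heatKernel σ z| / (2 * |σ|) + 3 * |oseenWeightA σ z| * ‖z‖ + |oseenWeightB σ z| * ‖z‖ ^ 3)
    (fun a b => by simpa [mul_assoc] using norm_oseenKernel_le σ z a b)

omit [FiniteDimensional ℝ E] [MeasurableSpace E] [BorelSpace E] in
/-- Unfolding `oseenKernelCLM`. [folklore] -/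
@[simp]
theorem oseenKernelCLM_apply (σ : ℝ) (z a b : E) : oseenKernelCLM σ z a b = oseenKernel σ z a b :=
  rfl

omit [FiniteDimensional ℝ E] [MeasurableSpace E] [BorelSpace E] in
/-- **Operator-norm form of Koch–Tataru's bound (14)**: there is `C = C(E) > 0` with
`‖K(σ, z)‖ ≤ C (σ + ‖z‖²)^{-(d+1)/2}` for `σ > 0`. [cite: KochTataruAdvMath2001, §3 (14)] -/
theorem exists_norm_oseenKernelCLM_le :
    ∃ C : ℝ, 0 < C ∧ ∀ {σ : ℝ}, 0 < σ → ∀ z : E,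
      ‖oseenKernelCLM σ z‖ ≤ C * (σ + ‖z‖ ^ 2) ^ (-(((Module.finrank ℝ E : ℝ) + 1) / 2)) := by
  obtain ⟨C, hC, hK⟩ := exists_norm_oseenKernel_le (E := E)
  refine ⟨C, hC, fun {σ} hσ z => ?_⟩
  have h0 : 0 ≤ C * (σ + ‖z‖ ^ 2) ^ (-(((Module.finrank ℝ E : ℝ) + 1) / 2)) :=
    mul_nonneg hC.le (Real.rpow_nonneg (by positivity) _)
  refine ContinuousLinearMap.opNorm_le_bound _ h0 fun a => ?_
  refine ContinuousLinearMap.opNorm_le_bound _ (by positivity) fun b => ?_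
  rw [oseenKernelCLM_apply]
  calc ‖oseenKernel σ z a b‖ ≤ C * (σ + ‖z‖ ^ 2) ^ (-(((Module.finrank ℝ E : ℝ) + 1) / 2)) * ‖a‖ * ‖b‖ :=
        hK hσ z a b
    _ = _ := by ring

end KernelCLM

/-! ### The parabolic weight and its mass -/

section Weight

/-- The integral `∫ (σ + ‖z‖²)^{-(d+1)/2} dz = σ^{-1/2} ∫ (1 + ‖w‖²)^{-(d+1)/2} dw` of the
envelope of Koch–Tataru's bound (14) (parabolic scaling; KNSS 2009, §3 (3.5): the source of the
factor `√T` in `‖B(u,v)‖ ≤ C√T‖u‖‖v‖`). [folklore] -/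
theorem integral_add_norm_sq_rpow_neg_half_succ {σ : ℝ} (hσ : 0 < σ) :
    ∫ z : E, (σ + ‖z‖ ^ 2) ^ (-(((Module.finrank ℝ E : ℝ) + 1) / 2)) =
      σ ^ (-(1 / 2 : ℝ)) * ∫ w : E, (1 + ‖w‖ ^ 2) ^ (-(((Module.finrank ℝ E : ℝ) + 1) / 2)) := by
  rw [integral_add_norm_sq_rpow_neg hσ]
  congr 1
  congr 1
  ring

/-- Integrability of the envelope `(σ + ‖z‖²)^{-(d+1)/2}`, `σ > 0`. [folklore] -/
theorem integrable_add_norm_sq_rpow_neg_half_succ {σ : ℝ} (hσ : 0 < σ) :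
    Integrable (fun z : E => (σ + ‖z‖ ^ 2) ^ (-(((Module.finrank ℝ E : ℝ) + 1) / 2))) :=
  integrable_add_norm_sq_rpow_neg (by linarith) hσ

end Weight

/-! ### The slice operator -/

section Slice

/-- **The Oseen slice operator** `N_σ[a, b](x) = ∫ K(σ, x − y)[a(y), b(y)] dy`, the value at `x`
of `e^{σΔ} P ∇·(a ⊗ b)` for the rank-one tensor field of two vector fields `a, b` (KNSS 2009, §3
(3.4) with `f_{jk} = −a_k b_j`, and §4 p. 8, the integrand of `B(u, v)`; Koch–Tataru 2001, (11)).
Bochner integral, junk `0` where divergent; absolutely convergent for bounded measurable fields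
and `σ > 0`. [cite: KochNadirashviliSereginSverak2009, §3 (3.4) and §4 p. 8 (arXiv:0709.3599v1)] -/
def oseenSlice (σ : ℝ) (a b : E → E) (x : E) : E :=
  ∫ y, oseenKernel σ (x - y) (a y) (b y)

/-- Unfolding `oseenSlice`. [folklore] -/
theorem oseenSlice_apply (σ : ℝ) (a b : E → E) (x : E) :
    oseenSlice σ a b x = ∫ y, oseenKernel σ (x - y) (a y) (b y) := rfl

/-- **Translation invariance**: `N_σ[a, b](x) = ∫ K(σ, z)[a(x − z), b(x − z)] dz`. [folklore] -/
theorem oseenSlice_eq_integral_sub (σ : ℝ) (a b : E → E) (x : E) :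
    oseenSlice σ a b x = ∫ z, oseenKernel σ z (a (x - z)) (b (x - z)) := by
  rw [oseenSlice_apply, ← integral_sub_left_eq_self _ volume x]
  refine integral_congr_ae (Eventually.of_forall fun z => ?_)
  simp only [sub_sub_cancel]

/-- `N_σ[0, b] = 0`. [folklore] -/
@[simp]
theorem oseenSlice_zero_left (σ : ℝ) (b : E → E) : oseenSlice σ 0 b = 0 := by
  funext x; simp [oseenSlice]

/-- `N_σ[a, 0] = 0`. [folklore] -/
@[simp]
theorem oseenSlice_zero_right (σ : ℝ) (a : E → E) : oseenSlice σ a 0 = 0 := by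
  funext x; simp [oseenSlice]

variable {σ : ℝ} {a b : E → E} {Ma Mb : ℝ}

omit [FiniteDimensional ℝ E] [MeasurableSpace E] [BorelSpace E] in
/-- Pointwise domination of the slice integrand by the parabolic envelope:
`‖K(σ, x − y)[a y, b y]‖ ≤ C M_a M_b (σ + ‖x − y‖²)^{-(d+1)/2}`. [cite: KochTataruAdvMath2001, §3 (14)] -/
theorem norm_oseenKernel_apply_le_weight {C : ℝ}
    (hK : ∀ {σ : ℝ}, 0 < σ → ∀ z a b : E,
      ‖oseenKernel σ z a b‖ ≤ C * (σ + ‖z‖ ^ 2) ^ (-(((Module.finrank ℝ E : ℝ) + 1) / 2)) * ‖a‖ * ‖b‖)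
    (hC : 0 ≤ C) (hσ : 0 < σ) (ha : ∀ y, ‖a y‖ ≤ Ma) (hb : ∀ y, ‖b y‖ ≤ Mb) (x y : E) :
    ‖oseenKernel σ (x - y) (a y) (b y)‖ ≤
      C * Ma * Mb * (σ + ‖x - y‖ ^ 2) ^ (-(((Module.finrank ℝ E : ℝ) + 1) / 2)) := by
  have hMa : 0 ≤ Ma := (norm_nonneg _).trans (ha y)
  have hw : 0 ≤ C * (σ + ‖x - y‖ ^ 2) ^ (-(((Module.finrank ℝ E : ℝ) + 1) / 2)) :=
    mul_nonneg hC (Real.rpow_nonneg (by positivity) _)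
  calc ‖oseenKernel σ (x - y) (a y) (b y)‖
      ≤ C * (σ + ‖x - y‖ ^ 2) ^ (-(((Module.finrank ℝ E : ℝ) + 1) / 2)) * ‖a y‖ * ‖b y‖ :=
        hK hσ (x - y) (a y) (b y)
    _ ≤ C * (σ + ‖x - y‖ ^ 2) ^ (-(((Module.finrank ℝ E : ℝ) + 1) / 2)) * Ma * Mb :=
        mul_le_mul (mul_le_mul_of_nonneg_left (ha y) hw) (hb y) (norm_nonneg _) (mul_nonneg hw hMa)
    _ = _ := by ring

/-- **Integrability of the slice integrand** for bounded a.e.-measurable fields and `σ > 0`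
(domination by the integrable parabolic envelope). [cite: KochTataruAdvMath2001, §3 (14)] -/
theorem integrable_oseenKernel_slice_of_bound (hσ : 0 < σ) (ham : AEStronglyMeasurable a volume)
    (hbm : AEStronglyMeasurable b volume) (ha : ∀ y, ‖a y‖ ≤ Ma) (hb : ∀ y, ‖b y‖ ≤ Mb) (x : E) :
    Integrable (fun y => oseenKernel σ (x - y) (a y) (b y)) volume := by
  obtain ⟨C, hC, hK⟩ := exists_norm_oseenKernel_le (E := E)
  have hw := ((integrable_add_norm_sq_rpow_neg_half_succ (E := E) hσ).comp_sub_left x).const_mul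
    (C * Ma * Mb)
  refine hw.mono' ?_ (Eventually.of_forall fun y =>
    norm_oseenKernel_apply_le_weight hK hC.le hσ ha hb x y)
  exact (AEMeasurable.oseenKernel_comp aemeasurable_const
    (measurable_id.const_sub x).aemeasurable ham.aemeasurable hbm.aemeasurable).aestronglyMeasurable

/-- **Sup bound of the slice operator** (KNSS 2009, §3 (3.5) ⇒ §4 p. 8: the kernel decay gives
`‖B(u,v)‖ ≤ C√T‖u‖‖v‖`; sliced form): there is `C₀ = C₀(E) > 0` with
`‖N_σ[a, b](x)‖ ≤ C₀ σ^{-1/2} M_a M_b` for `σ > 0` and fields with `‖a‖ ≤ M_a`, `‖b‖ ≤ M_b`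
(no measurability needed: a divergent Bochner integral is `0`). [cite: KochNadirashviliSereginSverak2009, §3 (3.5) and §4 p. 8 (arXiv:0709.3599v1)] -/
theorem exists_norm_oseenSlice_le :
    ∃ C₀ : ℝ, 0 < C₀ ∧ ∀ {σ : ℝ}, 0 < σ → ∀ {a b : E → E} {Ma Mb : ℝ},
      (∀ y, ‖a y‖ ≤ Ma) → (∀ y, ‖b y‖ ≤ Mb) → ∀ x,
        ‖oseenSlice σ a b x‖ ≤ C₀ * σ ^ (-(1 / 2 : ℝ)) * Ma * Mb := by
  obtain ⟨C, hC, hK⟩ := exists_norm_oseenKernel_le (E := E)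
  set I : ℝ := ∫ w : E, (1 + ‖w‖ ^ 2) ^ (-(((Module.finrank ℝ E : ℝ) + 1) / 2)) with hI
  have hI0 : 0 < I := integral_one_add_norm_sq_rpow_neg_pos (by linarith)
  refine ⟨C * I, by positivity, fun {σ} hσ {a b Ma Mb} ha hb x => ?_⟩
  have hw := ((integrable_add_norm_sq_rpow_neg_half_succ (E := E) hσ).comp_sub_left x).const_mul
    (C * Ma * Mb)
  rw [oseenSlice_apply]
  refine (norm_integral_le_of_norm_le hw (Eventually.of_forall fun y =>
    norm_oseenKernel_apply_le_weight hK hC.le hσ ha hb x y)).trans (le_of_eq ?_)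
  rw [integral_const_mul]
  have := integral_sub_left_eq_self
    (fun z : E => (σ + ‖z‖ ^ 2) ^ (-(((Module.finrank ℝ E : ℝ) + 1) / 2))) volume x
  rw [this, integral_add_norm_sq_rpow_neg_half_succ hσ]
  ring

/-- **Bilinearity, left slot**: `N_σ[a + a', b](x) = N_σ[a, b](x) + N_σ[a', b](x)` when both
slice integrands are integrable. [folklore] -/
theorem oseenSlice_add_left {a' : E → E} {x : E}
    (h : Integrable (fun y => oseenKernel σ (x - y) (a y) (b y)) volume)
    (h' : Integrable (fun y => oseenKernel σ (x - y) (a' y) (b y)) volume) :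
    oseenSlice σ (a + a') b x = oseenSlice σ a b x + oseenSlice σ a' b x := by
  simp only [oseenSlice_apply, Pi.add_apply, oseenKernel_add_left]
  exact integral_add h h'

/-- **Bilinearity, right slot**: `N_σ[a, b + b'](x) = N_σ[a, b](x) + N_σ[a, b'](x)` when both
slice integrands are integrable. [folklore] -/
theorem oseenSlice_add_right {b' : E → E} {x : E}
    (h : Integrable (fun y => oseenKernel σ (x - y) (a y) (b y)) volume)
    (h' : Integrable (fun y => oseenKernel σ (x - y) (a y) (b' y)) volume) :
    oseenSlice σ a (b + b') x = oseenSlice σ a b x + oseenSlice σ a b' x := by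
  simp only [oseenSlice_apply, Pi.add_apply, oseenKernel_add_right]
  exact integral_add h h'

/-- `N_σ[a − a', b](x) = N_σ[a, b](x) − N_σ[a', b](x)` (integrable slice integrands). [folklore] -/
theorem oseenSlice_sub_left {a' : E → E} {x : E}
    (h : Integrable (fun y => oseenKernel σ (x - y) (a y) (b y)) volume)
    (h' : Integrable (fun y => oseenKernel σ (x - y) (a' y) (b y)) volume) :
    oseenSlice σ (a - a') b x = oseenSlice σ a b x - oseenSlice σ a' b x := by
  simp only [oseenSlice_apply, Pi.sub_apply, oseenKernel_sub_left]
  exact integral_sub h h'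

/-- `N_σ[a, b − b'](x) = N_σ[a, b](x) − N_σ[a, b'](x)` (integrable slice integrands). [folklore] -/
theorem oseenSlice_sub_right {b' : E → E} {x : E}
    (h : Integrable (fun y => oseenKernel σ (x - y) (a y) (b y)) volume)
    (h' : Integrable (fun y => oseenKernel σ (x - y) (a y) (b' y)) volume) :
    oseenSlice σ a (b - b') x = oseenSlice σ a b x - oseenSlice σ a b' x := by
  simp only [oseenSlice_apply, Pi.sub_apply, oseenKernel_sub_right]
  exact integral_sub h h'

end Slice

/-! ### Measurability -/

section Measurability

/-- **Strong measurability of the slice operator with parameters**: for a measurable clock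
`c : P → ℝ` and jointly measurable families `A, B : P × E → E`, the map
`(p, x) ↦ N_{c(p)}[A(p, ·), B(p, ·)](x)` is strongly measurable (a parametric Bochner integral
of the jointly measurable kernel, `measurable_oseenKernel`). With `P = ℝ`, `c(τ) = ν(t − τ)`,
this is the measurability of the Duhamel integrand. [folklore] -/
theorem stronglyMeasurable_oseenSlice_param {P : Type*} [MeasurableSpace P] {c : P → ℝ}
    (hc : Measurable c) {A B : P → E → E} (hA : Measurable (uncurry A))
    (hB : Measurable (uncurry B)) :
    StronglyMeasurable (fun q : P × E => oseenSlice (c q.1) (A q.1) (B q.1) q.2) := by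
  have hA' : Measurable (fun r : (P × E) × E => A r.1.1 r.2) :=
    hA.comp (measurable_fst.fst.prodMk measurable_snd)
  have hB' : Measurable (fun r : (P × E) × E => B r.1.1 r.2) :=
    hB.comp (measurable_fst.fst.prodMk measurable_snd)
  have hm : Measurable (fun r : (P × E) × E =>
      oseenKernel (c r.1.1) (r.1.2 - r.2) (A r.1.1 r.2) (B r.1.1 r.2)) :=
    Measurable.oseenKernel_comp (hc.comp measurable_fst.fst) (measurable_fst.snd.sub measurable_snd)
      hA' hB'
  exact hm.stronglyMeasurable.integral_prod_right'

/-- Joint strong measurability of `(τ, x) ↦ N_{ν(t−τ)}[u(τ), v(τ)](x)` for jointly measurable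
families `u, v` (the Duhamel integrand of `oseenDuhamel ν s u v t`). [folklore] -/
theorem stronglyMeasurable_oseenSlice_duhamel (ν t : ℝ) {u v : ℝ → E → E}
    (hu : Measurable (uncurry u)) (hv : Measurable (uncurry v)) :
    StronglyMeasurable (fun q : ℝ × E => oseenSlice (ν * (t - q.1)) (u q.1) (v q.1) q.2) :=
  stronglyMeasurable_oseenSlice_param (measurable_const.mul (measurable_const.sub measurable_id))
    hu hv

end Measurability

/-! ### The semigroup law and smoothness -/

section Semigroup

variable {σ t : ℝ} {a b : E → E} {Ma Mb : ℝ}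

/-- **Semigroup law for slices**: `e^{tΔ}(N_σ[a, b])(x) = N_{σ+t}[a, b](x)` for `σ, t > 0` and
bounded measurable fields — the kernel-level law `∫ G_t(y') K(σ, z − y')[α, β] dy' = K(σ+t, z)[α, β]`
(`integral_heatKernel_smul_oseenKernel_sub`, `OseenKernelSemigroup.lean`) under the integral sign
(Fubini under the parabolic envelope). KNSS 2009, §4 p. 8: the Oseen form is restartable,
`e^{τΔ}P∇·` being `e^{τΔ}` composed with a fixed operator. [cite: KochNadirashviliSereginSverak2009, §4 p. 8 (arXiv:0709.3599v1)] -/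
theorem heatExtension_oseenSlice (hσ : 0 < σ) (ht : 0 < t) (ham : Measurable a)
    (hbm : Measurable b) (ha : ∀ y, ‖a y‖ ≤ Ma) (hb : ∀ y, ‖b y‖ ≤ Mb) (x : E) :
    heatExtension (oseenSlice σ a b) t x = oseenSlice (σ + t) a b x := by
  obtain ⟨C, hC, hK⟩ := exists_norm_oseenKernel_le (E := E)
  set I : ℝ := ∫ w : E, (1 + ‖w‖ ^ 2) ^ (-(((Module.finrank ℝ E : ℝ) + 1) / 2)) with hI
  -- the double integrand
  set H : E → E → E := fun y' y => heatKernel t y' • oseenKernel σ (x - y' - y) (a y) (b y) with hH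
  have hHm : Measurable (uncurry H) := by
    refine ((UnboundedOperators.continuous_heatKernel t).measurable.comp measurable_fst).smul ?_
    exact Measurable.oseenKernel_comp measurable_const
      ((measurable_fst.const_sub x).sub measurable_snd) (ham.comp measurable_snd)
      (hbm.comp measurable_snd)
  -- slices in `y` at fixed `y'` are (scaled) slice integrands at the base point `x - y'`
  have hslice : ∀ y', Integrable (fun y => H y' y) volume := fun y' =>
    (integrable_oseenKernel_slice_of_bound hσ ham.aestronglyMeasurable hbm.aestronglyMeasurable
      ha hb (x - y')).smul (heatKernel t y')
  -- the `y`-integral of the norm is bounded by a Gaussian in `y'`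
  have hnorm : ∀ y', ∫ y, ‖H y' y‖ ≤ heatKernel t y' * (C * Ma * Mb * (σ ^ (-(1 / 2 : ℝ)) * I)) := by
    intro y'
    have hG : 0 ≤ heatKernel t y' := (UnboundedOperators.heatKernel_pos ht y').le
    have hw := ((integrable_add_norm_sq_rpow_neg_half_succ (E := E) hσ).comp_sub_left
      (x - y')).const_mul (heatKernel t y' * (C * Ma * Mb))
    calc ∫ y, ‖H y' y‖
        ≤ ∫ y, heatKernel t y' * (C * Ma * Mb) *
            (σ + ‖x - y' - y‖ ^ 2) ^ (-(((Module.finrank ℝ E : ℝ) + 1) / 2)) := by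
          refine integral_mono_of_nonneg (Eventually.of_forall fun y => norm_nonneg _) hw
            (Eventually.of_forall fun y => ?_)
          simp only [hH, norm_smul, Real.norm_of_nonneg hG]
          rw [mul_assoc]
          exact mul_le_mul_of_nonneg_left
            (norm_oseenKernel_apply_le_weight hK hC.le hσ ha hb (x - y') y) hG
      _ = heatKernel t y' * (C * Ma * Mb * (σ ^ (-(1 / 2 : ℝ)) * I)) := by
          rw [integral_const_mul]
          have := integral_sub_left_eq_self
            (fun z : E => (σ + ‖z‖ ^ 2) ^ (-(((Module.finrank ℝ E : ℝ) + 1) / 2))) volume (x - y')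
          rw [this, integral_add_norm_sq_rpow_neg_half_succ hσ]
          ring
  have hHint : Integrable (uncurry H) ((volume : Measure E).prod volume) := by
    refine (integrable_prod_iff hHm.aestronglyMeasurable).2 ⟨Eventually.of_forall hslice, ?_⟩
    refine ((UnboundedOperators.integrable_heatKernel_holds ht).mul_const
      (C * Ma * Mb * (σ ^ (-(1 / 2 : ℝ)) * I))).mono' ?_ (Eventually.of_forall fun y' => ?_)
    · exact (hHm.stronglyMeasurable.norm.integral_prod_right).aestronglyMeasurable
    · rw [Real.norm_of_nonneg (integral_nonneg fun y => norm_nonneg _)]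
      exact hnorm y'
  -- Fubini
  rw [UnboundedOperators.heatExtension_apply]
  have hL : (fun y' => heatKernel t y' • oseenSlice σ a b (x - y')) = fun y' => ∫ y, H y' y := by
    funext y'
    rw [oseenSlice_apply, ← integral_smul]
  rw [hL, integral_integral_swap hHint, oseenSlice_apply]
  refine integral_congr_ae (Eventually.of_forall fun y => ?_)
  simp only [hH]
  have hre : (fun y' => heatKernel t y' • oseenKernel σ (x - y' - y) (a y) (b y)) =
      fun y' => heatKernel t y' • oseenKernel σ (x - y - y') (a y) (b y) := by
    funext y'; rw [sub_right_comm]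
  rw [hre, integral_heatKernel_smul_oseenKernel_sub hσ ht (a y) (b y) (x - y)]

/-- The slice at time `σ` is the heat flow of the slice at time `σ/2`:
`N_σ[a, b] = e^{(σ/2)Δ} N_{σ/2}[a, b]` (bounded measurable fields, `σ > 0`). [folklore] -/
theorem oseenSlice_eq_heatExtension_half (hσ : 0 < σ) (ham : Measurable a) (hbm : Measurable b)
    (ha : ∀ y, ‖a y‖ ≤ Ma) (hb : ∀ y, ‖b y‖ ≤ Mb) :
    oseenSlice σ a b = heatExtension (oseenSlice (σ / 2) a b) (σ / 2) := by
  funext x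
  rw [heatExtension_oseenSlice (half_pos hσ) (half_pos hσ) ham hbm ha hb x, add_halves]

/-- **Smoothness of slices of bounded measurable fields** (`σ > 0`): `N_σ[a, b] ∈ C^∞(E; E)` —
the caloric extension of the bounded measurable function `N_{σ/2}[a, b]` (KNSS 2009, Prop. 4.1
and Remark 4.2: the Oseen term smooths like the heat flow). [cite: KochNadirashviliSereginSverak2009, Prop. 4.1 and Remark 4.2 (arXiv:0709.3599v1 p. 8)] -/
theorem contDiff_oseenSlice (hσ : 0 < σ) (ham : Measurable a) (hbm : Measurable b)
    (ha : ∀ y, ‖a y‖ ≤ Ma) (hb : ∀ y, ‖b y‖ ≤ Mb) {n : ℕ∞} : ContDiff ℝ n (oseenSlice σ a b) := by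
  obtain ⟨C₀, hC₀, hN⟩ := exists_norm_oseenSlice_le (E := E)
  have hmem : MemLp (oseenSlice (σ / 2) a b) ∞ (volume : Measure E) :=
    memLp_top_of_bound (stronglyMeasurable_oseenSlice (σ / 2) ham.aestronglyMeasurable
      hbm.aestronglyMeasurable).aestronglyMeasurable _ (Eventually.of_forall (hN (half_pos hσ) ha hb))
  rw [oseenSlice_eq_heatExtension_half hσ ham hbm ha hb]
  exact (UnboundedOperators.contDiff_heatExtension_holds hmem le_top (half_pos hσ)).of_le
    (by exact_mod_cast le_top)

/-- **All-order derivative bounds for slices of bounded measurable fields**: for every `k` there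
is `C = C(k, E) ≥ 0` with `‖Dᵏ N_σ[a, b](x)‖ ≤ C σ^{-(k+1)/2} M_a M_b` for `σ > 0`, measurable
`a, b` with `‖a‖ ≤ M_a`, `‖b‖ ≤ M_b` (`N_σ = e^{(σ/2)Δ}N_{σ/2}`, the sup bound
`‖N_{σ/2}‖ ≤ C₀ (σ/2)^{-1/2} M_a M_b` and the heat-semigroup bounds
`‖Dᵏ e^{(σ/2)Δ} f‖ ≤ A_k (σ/2)^{-k/2} ‖f‖_∞`). KNSS 2009, Prop. 4.1 with Remark 4.2, and (3.12):
spatial derivatives of the mild solution cost `t^{-1/2}` each. [cite: KochNadirashviliSereginSverak2009, Prop. 4.1, Remark 4.2, (3.12) (arXiv:0709.3599v1 pp. 6–8)] -/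
theorem exists_norm_iteratedFDeriv_oseenSlice_le (k : ℕ) :
    ∃ C : ℝ, 0 ≤ C ∧ ∀ {σ : ℝ}, 0 < σ → ∀ {a b : E → E} {Ma Mb : ℝ},
      Measurable a → Measurable b → (∀ y, ‖a y‖ ≤ Ma) → (∀ y, ‖b y‖ ≤ Mb) → ∀ x,
        ‖iteratedFDeriv ℝ k (oseenSlice σ a b) x‖ ≤ C * σ ^ (-((k : ℝ) + 1) / 2) * Ma * Mb := by
  obtain ⟨C₀, hC₀, hN⟩ := exists_norm_oseenSlice_le (E := E)
  obtain ⟨A, hA, hD⟩ := UnboundedOperators.exists_norm_iteratedFDeriv_heatExtension_le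
    (E := E) (F := E) k
  refine ⟨A * C₀ * 2 ^ (((k : ℝ) + 1) / 2), by positivity,
    fun {σ} hσ {a b Ma Mb} ham hbm ha hb x => ?_⟩
  have hσ2 : 0 < σ / 2 := half_pos hσ
  have hbd : ∀ z, ‖oseenSlice (σ / 2) a b z‖ ≤ C₀ * (σ / 2) ^ (-(1 / 2 : ℝ)) * Ma * Mb :=
    hN hσ2 ha hb
  rw [oseenSlice_eq_heatExtension_half hσ ham hbm ha hb]
  refine (hD hσ2 (stronglyMeasurable_oseenSlice (σ / 2) ham.aestronglyMeasurable
    hbm.aestronglyMeasurable).aestronglyMeasurable hbd x).trans (le_of_eq ?_)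
  have hsplit : ∀ e : ℝ, (σ / 2) ^ e = σ ^ e * 2 ^ (-e) := fun e => by
    rw [Real.div_rpow hσ.le zero_le_two, Real.rpow_neg zero_le_two, div_eq_mul_inv]
  have h2 : (2 : ℝ) ^ (((k : ℝ) + 1) / 2) = 2 ^ (-(-(k : ℝ) / 2)) * 2 ^ (-(-(1 / 2 : ℝ))) := by
    rw [← Real.rpow_add two_pos]; congr 1; ring
  have hss : σ ^ (-((k : ℝ) + 1) / 2) = σ ^ (-(k : ℝ) / 2) * σ ^ (-(1 / 2 : ℝ)) := by
    rw [← Real.rpow_add hσ]; congr 1; ring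
  rw [hsplit (-(k : ℝ) / 2), hsplit (-(1 / 2 : ℝ)), h2, hss]
  ring

/-- First-order instance: `‖D N_σ[a, b](x)‖ ≤ C₁ σ⁻¹ M_a M_b`. [cite: KochNadirashviliSereginSverak2009, (3.12) (arXiv:0709.3599v1 p. 6)] -/
theorem exists_norm_fderiv_oseenSlice_le :
    ∃ C : ℝ, 0 ≤ C ∧ ∀ {σ : ℝ}, 0 < σ → ∀ {a b : E → E} {Ma Mb : ℝ},
      Measurable a → Measurable b → (∀ y, ‖a y‖ ≤ Ma) → (∀ y, ‖b y‖ ≤ Mb) → ∀ x,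
        ‖fderiv ℝ (oseenSlice σ a b) x‖ ≤ C * σ ^ (-(1 : ℝ)) * Ma * Mb := by
  obtain ⟨C, hC, h⟩ := exists_norm_iteratedFDeriv_oseenSlice_le (E := E) 1
  refine ⟨C, hC, fun {σ} hσ {a b Ma Mb} ham hbm ha hb x => ?_⟩
  have := h hσ ham hbm ha hb x
  rw [norm_iteratedFDeriv_one] at this
  convert this using 3
  norm_num

end Semigroup

/-! ### Derivatives on `C¹` data -/

section Deriv

variable {σ : ℝ} {a b : E → E} {Ma Mb Da Db : ℝ}

/-- Integrability of the translated slice integrand `z ↦ K(σ, z)[a(x − z), b(x − z)]` for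
bounded measurable fields. [folklore] -/
theorem integrable_oseenKernel_slice_sub (hσ : 0 < σ) (ham : Measurable a) (hbm : Measurable b)
    (ha : ∀ y, ‖a y‖ ≤ Ma) (hb : ∀ y, ‖b y‖ ≤ Mb) (x : E) :
    Integrable (fun z => oseenKernel σ z (a (x - z)) (b (x - z))) volume := by
  have h := (integrable_oseenKernel_slice_of_bound hσ ham.aestronglyMeasurable
    hbm.aestronglyMeasurable ha hb x).comp_sub_left x
  refine h.congr (Eventually.of_forall fun z => ?_)
  simp only [sub_sub_cancel]

/-- **Differentiation under the integral sign along a line**: for bounded `C¹` fields `a, b`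
with bounded derivatives and `σ > 0`,
`d/ds N_σ[a, b](x + s h)|_{s=0} = N_σ[∂_h a, b](x) + N_σ[a, ∂_h b](x)` (translation invariance
of the slice operator and the product rule for the bilinear kernel). [folklore] -/
theorem hasDerivAt_oseenSlice_comp_lineSeg (hσ : 0 < σ) (ha1 : ContDiff ℝ 1 a)
    (hb1 : ContDiff ℝ 1 b) (ha : ∀ y, ‖a y‖ ≤ Ma) (hb : ∀ y, ‖b y‖ ≤ Mb)
    (hDa : ∀ y, ‖fderiv ℝ a y‖ ≤ Da) (hDb : ∀ y, ‖fderiv ℝ b y‖ ≤ Db) (x h : E) :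
    HasDerivAt (fun s : ℝ => oseenSlice σ a b (x + s • h))
      (oseenSlice σ (fun y => fderiv ℝ a y h) b x + oseenSlice σ a (fun y => fderiv ℝ b y h) x)
      0 := by
  obtain ⟨C, hC, hK⟩ := exists_norm_oseenKernelCLM_le (E := E)
  have ham : Measurable a := ha1.continuous.measurable
  have hbm : Measurable b := hb1.continuous.measurable
  have hac : Continuous fun y => fderiv ℝ a y h := (ha1.continuous_fderiv one_ne_zero).clm_apply
    continuous_const
  have hbc : Continuous fun y => fderiv ℝ b y h := (hb1.continuous_fderiv one_ne_zero).clm_apply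
    continuous_const
  have hah : ∀ y, ‖fderiv ℝ a y h‖ ≤ Da * ‖h‖ := fun y =>
    (ContinuousLinearMap.le_opNorm _ _).trans (mul_le_mul_of_nonneg_right (hDa y) (norm_nonneg _))
  have hbh : ∀ y, ‖fderiv ℝ b y h‖ ≤ Db * ‖h‖ := fun y =>
    (ContinuousLinearMap.le_opNorm _ _).trans (mul_le_mul_of_nonneg_right (hDb y) (norm_nonneg _))
  have hMa : 0 ≤ Ma := (norm_nonneg _).trans (ha x)
  have hMb : 0 ≤ Mb := (norm_nonneg _).trans (hb x)
  have hDa0 : 0 ≤ Da := (norm_nonneg _).trans (hDa x)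
  have hDb0 : 0 ≤ Db := (norm_nonneg _).trans (hDb x)
  -- the integrand along the line and its derivative
  set F : ℝ → E → E := fun s z => oseenKernel σ z (a (x + s • h - z)) (b (x + s • h - z)) with hF
  set F' : ℝ → E → E := fun s z =>
    oseenKernel σ z (fderiv ℝ a (x + s • h - z) h) (b (x + s • h - z)) +
      oseenKernel σ z (a (x + s • h - z)) (fderiv ℝ b (x + s • h - z) h) with hF'
  have hfun : (fun s : ℝ => oseenSlice σ a b (x + s • h)) = fun s => ∫ z, F s z := by
    funext s; rw [oseenSlice_eq_integral_sub]
  rw [hfun]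
  -- measurability
  have hFm : ∀ s, AEStronglyMeasurable (F s) volume := fun s =>
    (Measurable.oseenKernel_comp measurable_const measurable_id
      (ham.comp (measurable_id.const_sub (x + s • h)))
      (hbm.comp (measurable_id.const_sub (x + s • h)))).aestronglyMeasurable
  have hF'm : AEStronglyMeasurable (F' 0) volume := by
    refine Measurable.aestronglyMeasurable (Measurable.add ?_ ?_)
    · exact Measurable.oseenKernel_comp measurable_const measurable_id
        (hac.measurable.comp (measurable_id.const_sub (x + (0 : ℝ) • h)))
        (hbm.comp (measurable_id.const_sub (x + (0 : ℝ) • h)))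
    · exact Measurable.oseenKernel_comp measurable_const measurable_id
        (ham.comp (measurable_id.const_sub (x + (0 : ℝ) • h)))
        (hbc.measurable.comp (measurable_id.const_sub (x + (0 : ℝ) • h)))
  -- integrability at `s = 0`
  have hF0 : Integrable (F 0) volume := by
    have := integrable_oseenKernel_slice_sub hσ ham hbm ha hb x
    simpa [hF] using this
  -- domination of the derivative
  set bound : E → ℝ := fun z => C * (σ + ‖z‖ ^ 2) ^ (-(((Module.finrank ℝ E : ℝ) + 1) / 2)) *
    (Da * ‖h‖ * Mb + Ma * (Db * ‖h‖)) with hbound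
  have hbound_int : Integrable bound volume :=
    ((integrable_add_norm_sq_rpow_neg_half_succ (E := E) hσ).const_mul C).mul_const _
  have hdom : ∀ᵐ z ∂(volume : Measure E), ∀ s ∈ ball (0 : ℝ) 1, ‖F' s z‖ ≤ bound z := by
    refine Eventually.of_forall fun z s _ => ?_
    have hKz := hK hσ z
    have hw : 0 ≤ C * (σ + ‖z‖ ^ 2) ^ (-(((Module.finrank ℝ E : ℝ) + 1) / 2)) :=
      mul_nonneg hC.le (Real.rpow_nonneg (by positivity) _)
    refine (norm_add_le _ _).trans ?_
    simp only [hbound]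
    rw [mul_add]
    refine add_le_add ?_ ?_
    · rw [← oseenKernelCLM_apply]
      calc ‖oseenKernelCLM σ z (fderiv ℝ a (x + s • h - z) h) (b (x + s • h - z))‖
          ≤ ‖oseenKernelCLM σ z‖ * ‖fderiv ℝ a (x + s • h - z) h‖ * ‖b (x + s • h - z)‖ :=
            ContinuousLinearMap.le_opNorm₂ _ _ _
        _ ≤ C * (σ + ‖z‖ ^ 2) ^ (-(((Module.finrank ℝ E : ℝ) + 1) / 2)) * (Da * ‖h‖) * Mb :=
            mul_le_mul (mul_le_mul hKz (hah _) (norm_nonneg _) hw) (hb _) (norm_nonneg _)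
              (mul_nonneg hw (mul_nonneg hDa0 (norm_nonneg _)))
        _ = _ := by ring
    · rw [← oseenKernelCLM_apply]
      calc ‖oseenKernelCLM σ z (a (x + s • h - z)) (fderiv ℝ b (x + s • h - z) h)‖
          ≤ ‖oseenKernelCLM σ z‖ * ‖a (x + s • h - z)‖ * ‖fderiv ℝ b (x + s • h - z) h‖ :=
            ContinuousLinearMap.le_opNorm₂ _ _ _
        _ ≤ C * (σ + ‖z‖ ^ 2) ^ (-(((Module.finrank ℝ E : ℝ) + 1) / 2)) * Ma * (Db * ‖h‖) :=
            mul_le_mul (mul_le_mul hKz (ha _) (norm_nonneg _) hw) (hbh _) (norm_nonneg _)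
              (mul_nonneg hw hMa)
        _ = _ := by ring
  -- pointwise differentiability in `s`
  have hdiff : ∀ᵐ z ∂(volume : Measure E), ∀ s ∈ ball (0 : ℝ) 1,
      HasDerivAt (fun s => F s z) (F' s z) s := by
    refine Eventually.of_forall fun z s _ => ?_
    have hγ : HasDerivAt (fun s : ℝ => x + s • h - z) h s := by
      simpa using (((hasDerivAt_id s).smul_const h).const_add x).sub_const z
    have hda : HasDerivAt (fun s : ℝ => a (x + s • h - z)) (fderiv ℝ a (x + s • h - z) h) s :=
      ((ha1.differentiable one_ne_zero _).hasFDerivAt.comp_hasDerivAt s hγ)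
    have hdb : HasDerivAt (fun s : ℝ => b (x + s • h - z)) (fderiv ℝ b (x + s • h - z) h) s :=
      ((hb1.differentiable one_ne_zero _).hasFDerivAt.comp_hasDerivAt s hγ)
    have hc : HasDerivAt (fun s : ℝ => oseenKernelCLM σ z (a (x + s • h - z)))
        (oseenKernelCLM σ z (fderiv ℝ a (x + s • h - z) h)) s :=
      (oseenKernelCLM σ z).hasFDerivAt.comp_hasDerivAt s hda
    exact hc.clm_apply hdb
  have hmain := (hasDerivAt_integral_of_dominated_loc_of_deriv_le (ball_mem_nhds (0 : ℝ) zero_lt_one)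
    (Eventually.of_forall hFm) hF0 hF'm hdom hbound_int hdiff).2
  -- identify the derivative
  have hint1 : Integrable (fun z => oseenKernel σ z (fderiv ℝ a (x - z) h) (b (x - z))) volume :=
    integrable_oseenKernel_slice_sub hσ hac.measurable hbm hah hb x
  have hint2 : Integrable (fun z => oseenKernel σ z (a (x - z)) (fderiv ℝ b (x - z) h)) volume :=
    integrable_oseenKernel_slice_sub hσ ham hbc.measurable ha hbh x
  have hval : ∫ z, F' 0 z = oseenSlice σ (fun y => fderiv ℝ a y h) b x +
      oseenSlice σ a (fun y => fderiv ℝ b y h) x := by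
    simp only [hF', zero_smul, add_zero]
    rw [integral_add hint1 hint2, oseenSlice_eq_integral_sub, oseenSlice_eq_integral_sub]
  rwa [hval] at hmain

/-- **Derivatives fall on `C¹` data**: for bounded `C¹` fields `a, b` with bounded derivatives and
`σ > 0`, `D(N_σ[a, b])(x) h = N_σ[∂_h a, b](x) + N_σ[a, ∂_h b](x)` (KNSS 2009, (3.12): "taking
difference quotients, we see that … we have similar estimates for spatial derivatives"). [cite: KochNadirashviliSereginSverak2009, (3.12) (arXiv:0709.3599v1 p. 6)] -/
theorem fderiv_oseenSlice_apply_of_contDiff (hσ : 0 < σ) (ha1 : ContDiff ℝ 1 a)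
    (hb1 : ContDiff ℝ 1 b) (ha : ∀ y, ‖a y‖ ≤ Ma) (hb : ∀ y, ‖b y‖ ≤ Mb)
    (hDa : ∀ y, ‖fderiv ℝ a y‖ ≤ Da) (hDb : ∀ y, ‖fderiv ℝ b y‖ ≤ Db) (x h : E) :
    fderiv ℝ (oseenSlice σ a b) x h =
      oseenSlice σ (fun y => fderiv ℝ a y h) b x + oseenSlice σ a (fun y => fderiv ℝ b y h) x := by
  have hd : DifferentiableAt ℝ (oseenSlice σ a b) x :=
    (contDiff_oseenSlice hσ ha1.continuous.measurable hb1.continuous.measurable ha hb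
      (n := 1)).differentiable one_ne_zero x
  have hγ : HasDerivAt (fun s : ℝ => x + s • h) h 0 := by
    simpa using ((hasDerivAt_id (0 : ℝ)).smul_const h).const_add x
  have h1 : HasDerivAt (fun s : ℝ => oseenSlice σ a b (x + s • h))
      (fderiv ℝ (oseenSlice σ a b) x h) 0 := by
    have hd' : HasFDerivAt (oseenSlice σ a b) (fderiv ℝ (oseenSlice σ a b) x) (x + (0 : ℝ) • h) := by
      rw [zero_smul, add_zero]; exact hd.hasFDerivAt
    exact hd'.comp_hasDerivAt (0 : ℝ) hγ
  exact h1.unique (hasDerivAt_oseenSlice_comp_lineSeg hσ ha1 hb1 ha hb hDa hDb x h)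

end Deriv

end Literature.Analysis.FluidPDE

end
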